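import Literature.Computability.Cryptography.WordRAMStructuredBlocks
import Literature.Computability.Complexity.TM2Window
import HarnessLib

/-!
# Multi-stack Turing machines on the word RAM, I: stacks in memory and the statement compiler

A verified simulation of Mathlib's multi-stack machines (`Turing.TM2.Stmt`, `Turing.TM2.stepAux`,
bundled as `Turing.FinTM2`) by structured word-RAM code (`SProg` of
`Literature.Computability.Cryptography.WordRAMStructured`), with constant overhead per machine
step. This is the machine-level content of the folklore half of the robustness of exponential-time
hypotheses under the machine model ("a fast Turing-machine algorithm is a fast RAM algorithm";
Papadimitriou, *Computational Complexity* (1994), §2.6: a RAM simulates a multitape Turing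
machine with constant overhead; Cook–Reckhow, JCSS 7 (1973), §2; V. Vassilevska Williams, ICM 2018, §2), in the form needed for
`Literature.Computability.FineGrained.kSATInRAMTime_of_kSATInExpTime`.

This file:

* `stackCell`, `dataMem G Q κ S`, `cellAddr` — the memory layout: below the base `Q` an arbitrary
  frozen part `G`; at `Q + i` (`i < κ`) the address of the top cell of stack `i`; the cells of the
  `κ` stacks interleaved above, cell `j ≥ 1` of stack `i` (counted from the bottom) at
  `Q + κ + κ j + i`, a dummy `0` at `j = 0` and `0` above the top (pops clear the vacated cell, so
  the memory is a *function* of the stack contents); `dataMem_push`, `dataMem_pop`;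
* the blocks `pushOps`, `popOps`, `topOps` (registers `4` = `Q`, `5`, `6`, `7` = scratch / top
  symbol) with their semantics `push_exec`, `pop_exec`, `top_exec`;
* `switchL` — dispatch on the value of register `7` by a chain of tests (the word RAM has no
  computed jump), `switchL_exec`;
* `Enc` — numberings of stacks, labels, states and stack symbols of a machine; `comp E q v` —
  the **static-state compiler** of a statement `q` run from internal state `v`: the internal
  state is a compile-time constant (a `load` changes the constant, a `branch` is resolved at compile
  time, a `peek`/`pop` dispatches on the top symbol and continues with the constant `f v a` in each
  branch), so that no function table is needed at run time; `comp_exec` — **`comp E q v` simulates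
  `TM2.stepAux q v S`** on `dataMem`, within `cost E q` steps, leaving the codes of the new label and
  state in registers `2`, `3`.

The growth of the stacks per step and the symbol invariant are those of
`Literature.Computability.Complexity.TimeBoundsProofs` (`TM2Comp.pushBound`,
`TM2Comp.length_stepAux_le`) and `Literature.Computability.Complexity.TM2Window`
(`TM2Sim.PushesSym`, `TM2Sim.stepAux_stk_mem`). The loop over machine steps, the loader of the
input stack and the run theorem are in `TM2ToWordRAMRun.lean` / `TM2ToWordRAMMachine.lean`.

## References

* C. H. Papadimitriou, *Computational Complexity*, Addison-Wesley 1994, §2.6 (random access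
  machines; Turing machines are simulated by RAM programs with constant overhead).
* S. A. Cook, R. A. Reckhow, *Time bounded random access machines*, JCSS 7 (1973), §2.
* V. Vassilevska Williams, *On some fine-grained questions in algorithms and complexity*,
  Proc. ICM 2018, §2 (the word RAM as the machine model of fine-grained complexity).
* T. Nipkow, G. Klein, *Concrete Semantics with Isabelle/HOL*, Springer 2014, Ch. 7–8.
-/

namespace Literature.Computability.Cryptography.WordRAM

open StateTransition Turing

/-! ## Stacks in memory -/

/-- Cell `j` of a stack whose contents, top first, are the code list `l`: the dummy `0` for
`j = 0`, the `j`-th symbol from the bottom for `1 ≤ j ≤ |l|`, and `0` above the top. [folklore] -/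
def stackCell (l : List ℕ) (j : ℕ) : ℕ :=
  if j = 0 then 0 else l.reverse.getD (j - 1) 0

/-- The dummy bottom cell. [folklore] -/
@[simp] theorem stackCell_zero (l : List ℕ) : stackCell l 0 = 0 := rfl

/-- The empty stack has only zero cells. [folklore] -/
@[simp] theorem stackCell_nil (j : ℕ) : stackCell [] j = 0 := by
  unfold stackCell; split_ifs <;> simp

/-- Above the top every cell is `0`. [folklore] -/
theorem stackCell_of_length_lt {l : List ℕ} {j : ℕ} (h : l.length < j) : stackCell l j = 0 := by
  unfold stackCell
  rw [if_neg (by omega), List.getD_eq_default _ _ (by simp; omega)]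

/-- The top cell holds the top symbol (`0` for the empty stack). [folklore] -/
theorem stackCell_length (l : List ℕ) : stackCell l l.length = l.headD 0 := by
  cases l with
  | nil => rfl
  | cons c l =>
    unfold stackCell
    rw [if_neg (by simp), List.reverse_cons, List.length_cons, Nat.add_sub_cancel,
      List.getD_append_right _ _ _ _ (by simp)]
    simp

/-- Pushing writes the new top cell and nothing else. [folklore] -/
theorem stackCell_cons (c : ℕ) (l : List ℕ) (j : ℕ) :
    stackCell (c :: l) j = if j = l.length + 1 then c else stackCell l j := by
  by_cases hj : j = l.length + 1
  · subst hj
    rw [if_pos rfl, ← List.length_cons (a := c), stackCell_length]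
    rfl
  rw [if_neg hj]
  unfold stackCell
  by_cases h0 : j = 0
  · simp [h0]
  rw [if_neg h0, if_neg h0, List.reverse_cons]
  by_cases hlt : j - 1 < l.length
  · rw [List.getD_append _ _ _ _ (by simpa using hlt)]
  · rw [List.getD_eq_default _ _ (by simp; omega), List.getD_eq_default _ _ (by simp; omega)]

/-- Popping clears the old top cell and nothing else. [folklore] -/
theorem stackCell_tail (l : List ℕ) (j : ℕ) :
    stackCell l.tail j = if j = l.length then 0 else stackCell l j := by
  cases l with
  | nil => simp
  | cons c l =>
    rw [List.tail_cons, List.length_cons, stackCell_cons]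
    by_cases hj : j = l.length + 1
    · rw [if_pos hj, stackCell_of_length_lt (by omega)]
    · rw [if_neg hj, if_neg hj]

/-- The address of cell `j` of stack `i`: the `κ` stacks are interleaved above the pointer table
`[Q, Q + κ)`. [folklore] -/
def cellAddr (Q κ i j : ℕ) : ℕ := Q + κ + κ * j + i

/-- The next cell up is `κ` addresses further. [folklore] -/
theorem cellAddr_succ (Q κ i j : ℕ) : cellAddr Q κ i (j + 1) = cellAddr Q κ i j + κ := by
  unfold cellAddr; ring

/-- Cells sit above the pointer table. [folklore] -/
theorem le_cellAddr (Q κ i j : ℕ) : Q + κ ≤ cellAddr Q κ i j := by unfold cellAddr; omega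

/-- `cellAddr` is monotone in the height. [folklore] -/
theorem cellAddr_le_cellAddr {Q κ i j j' : ℕ} (h : j ≤ j') : cellAddr Q κ i j ≤ cellAddr Q κ i j' := by
  unfold cellAddr; have := Nat.mul_le_mul_left κ h; omega

/-- Stack index and height are recovered from a cell address by division with remainder. [folklore] -/
theorem cellAddr_mod_div {Q κ i : ℕ} (hi : i < κ) (j : ℕ) :
    (cellAddr Q κ i j - (Q + κ)) % κ = i ∧ (cellAddr Q κ i j - (Q + κ)) / κ = j := by
  have hκ : 0 < κ := by omega
  have h : cellAddr Q κ i j - (Q + κ) = i + κ * j := by unfold cellAddr; omega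
  rw [h, Nat.add_mul_mod_self_left, Nat.mod_eq_of_lt hi, Nat.add_mul_div_left _ _ hκ,
    Nat.div_eq_of_lt hi, Nat.zero_add]
  exact ⟨rfl, rfl⟩

/-- Every address above the pointer table is a cell address. [folklore] -/
theorem cellAddr_of_le {Q κ a : ℕ} (ha : Q + κ ≤ a) :
    a = cellAddr Q κ ((a - (Q + κ)) % κ) ((a - (Q + κ)) / κ) := by
  unfold cellAddr
  have := Nat.div_add_mod (a - (Q + κ)) κ
  omega

/-- `cellAddr` is injective in (stack, height) for stack indices below `κ`. [folklore] -/
theorem cellAddr_inj {Q κ i i' j j' : ℕ} (hi : i < κ) (hi' : i' < κ)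
    (h : cellAddr Q κ i j = cellAddr Q κ i' j') : i = i' ∧ j = j' := by
  have h1 := cellAddr_mod_div (Q := Q) hi j
  have h2 := cellAddr_mod_div (Q := Q) hi' j'
  rw [h] at h1
  exact ⟨h1.1.symm.trans h2.1, h1.2.symm.trans h2.2⟩

/-- **The data memory of a stack configuration.** Below `Q`: the frozen part `G`. At `Q + i`
(`i < κ`): the address `cellAddr Q κ i |S i|` of the top cell of stack `i` (the dummy cell when the
stack is empty). Above: the interleaved cells, `stackCell (S i) j` at `cellAddr Q κ i j`. The
stacks are indexed by `ℕ` (indices `≥ κ` are never used) and hold code lists, top first. [folklore] -/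
def dataMem (G : ℕ → ℕ) (Q κ : ℕ) (S : ℕ → List ℕ) : ℕ → ℕ := fun a =>
  if a < Q then G a
  else if a < Q + κ then cellAddr Q κ (a - Q) (S (a - Q)).length
  else stackCell (S ((a - (Q + κ)) % κ)) ((a - (Q + κ)) / κ)

/-- The frozen part. [folklore] -/
theorem dataMem_of_lt (G : ℕ → ℕ) {Q : ℕ} (κ : ℕ) (S : ℕ → List ℕ) {a : ℕ} (ha : a < Q) :
    dataMem G Q κ S a = G a := if_pos ha

/-- The pointer table. [folklore] -/
theorem dataMem_ptr (G : ℕ → ℕ) (Q : ℕ) {κ : ℕ} (S : ℕ → List ℕ) {i : ℕ} (hi : i < κ) :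
    dataMem G Q κ S (Q + i) = cellAddr Q κ i (S i).length := by
  unfold dataMem
  rw [if_neg (by omega), if_pos (by omega), Nat.add_sub_cancel_left]

/-- The cells. [folklore] -/
theorem dataMem_cellAddr (G : ℕ → ℕ) (Q : ℕ) {κ : ℕ} (S : ℕ → List ℕ) {i : ℕ} (hi : i < κ) (j : ℕ) :
    dataMem G Q κ S (cellAddr Q κ i j) = stackCell (S i) j := by
  have h := cellAddr_mod_div (Q := Q) hi j
  have hle := le_cellAddr Q κ i j
  unfold dataMem
  rw [if_neg (by omega), if_neg (by omega), h.1, h.2]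

/-- Changing one stack does not change the memory away from its pointer and the cells where the
old and the new contents differ. [folklore] -/
theorem dataMem_update_of_ne (G : ℕ → ℕ) (Q : ℕ) {κ : ℕ} (S : ℕ → List ℕ) (i : ℕ)
    (l : List ℕ) {a : ℕ} (hptr : a ≠ Q + i)
    (hcell : ∀ j, a = cellAddr Q κ i j → stackCell l j = stackCell (S i) j) :
    dataMem G Q κ (Function.update S i l) a = dataMem G Q κ S a := by
  unfold dataMem
  by_cases h1 : a < Q
  · rw [if_pos h1, if_pos h1]
  rw [if_neg h1, if_neg h1]
  by_cases h2 : a < Q + κ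
  · rw [if_pos h2, if_pos h2, Function.update_of_ne (show a - Q ≠ i by omega)]
  rw [if_neg h2, if_neg h2]
  by_cases h3 : (a - (Q + κ)) % κ = i
  · rw [h3, Function.update_self]
    refine hcell _ ?_
    have := cellAddr_of_le (Q := Q) (κ := κ) (a := a) (by omega)
    rwa [h3] at this
  · rw [Function.update_of_ne h3]

/-- **Push on the memory**: writing the new pointer and the new top cell turns the memory of `S`
into the memory of `S` with `c` pushed on stack `i`. [folklore] -/
theorem dataMem_push (G : ℕ → ℕ) (Q : ℕ) {κ i : ℕ} (hi : i < κ) (S : ℕ → List ℕ) (c : ℕ) :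
    Function.update (Function.update (dataMem G Q κ S) (Q + i) (cellAddr Q κ i ((S i).length + 1)))
        (cellAddr Q κ i ((S i).length + 1)) c =
      dataMem G Q κ (Function.update S i (c :: S i)) := by
  funext a
  by_cases ha1 : a = cellAddr Q κ i ((S i).length + 1)
  · subst ha1
    rw [Function.update_self, dataMem_cellAddr G Q _ hi, Function.update_self, stackCell_cons,
      if_pos rfl]
  rw [Function.update_of_ne ha1]
  by_cases ha2 : a = Q + i
  · subst ha2
    rw [Function.update_self, dataMem_ptr G Q _ hi, Function.update_self, List.length_cons]
  rw [Function.update_of_ne ha2, dataMem_update_of_ne G Q S i (c :: S i) ha2]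
  intro j hj
  rw [stackCell_cons, if_neg]
  rintro rfl
  exact ha1 hj

/-- **Pop on the memory**: clearing the top cell and writing the new pointer turns the memory of
`S` into the memory of `S` with stack `i` popped. [folklore] -/
theorem dataMem_pop (G : ℕ → ℕ) (Q : ℕ) {κ i : ℕ} (hi : i < κ) (S : ℕ → List ℕ) :
    Function.update (Function.update (dataMem G Q κ S) (cellAddr Q κ i (S i).length) 0) (Q + i)
        (cellAddr Q κ i ((S i).length - 1)) =
      dataMem G Q κ (Function.update S i (S i).tail) := by
  funext a
  by_cases ha2 : a = Q + i
  · subst ha2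
    rw [Function.update_self, dataMem_ptr G Q _ hi, Function.update_self, List.length_tail]
  rw [Function.update_of_ne ha2]
  by_cases ha1 : a = cellAddr Q κ i (S i).length
  · subst ha1
    rw [Function.update_self, dataMem_cellAddr G Q _ hi, Function.update_self, stackCell_tail,
      if_pos rfl]
  rw [Function.update_of_ne ha1, dataMem_update_of_ne G Q S i (S i).tail ha2]
  intro j hj
  rw [stackCell_tail, if_neg]
  rintro rfl
  exact ha1 hj


/-! ## The stack blocks

Register conventions of the simulator: `2` = label code (`0` = halted), `3` = state code,
`4` = the base `Q` of the data layout, `5`, `6` = scratch, `7` = the symbol code dispatched on. -/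

/-- Push the symbol code `c` on stack `i`:
`r5 := Q + i; r6 := mem[r5]; r6 += κ; mem[r5] := r6; mem[r6] := c`. [folklore] -/
def pushOps (κ i c : ℕ) : List OpSpec :=
  [(.add, .dir 5, .dir 4, .imm i), (.add, .dir 6, .ind 5, .imm 0), (.add, .dir 6, .dir 6, .imm κ),
    (.add, .ind 5, .dir 6, .imm 0), (.add, .ind 6, .imm c, .imm 0)]

/-- Pop stack `i` (assumed nonempty), clearing the vacated cell:
`r5 := Q + i; r6 := mem[r5]; mem[r6] := 0; r6 -= κ; mem[r5] := r6`. [folklore] -/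
def popOps (κ i : ℕ) : List OpSpec :=
  [(.add, .dir 5, .dir 4, .imm i), (.add, .dir 6, .ind 5, .imm 0), (.add, .ind 6, .imm 0, .imm 0),
    (.sub, .dir 6, .dir 6, .imm κ), (.add, .ind 5, .dir 6, .imm 0)]

/-- Read the code of the top symbol of stack `i` (`0` if empty) into register `7`:
`r5 := Q + i; r6 := mem[r5]; r7 := mem[r6]`. [folklore] -/
def topOps (i : ℕ) : List OpSpec :=
  [(.add, .dir 5, .dir 4, .imm i), (.add, .dir 6, .ind 5, .imm 0), (.add, .dir 7, .ind 6, .imm 0)]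

namespace SProg

section blocks

variable {w : ℕ} {O : List ℕ → List ℕ}

/-- **Semantics of `pushOps`.** [folklore] -/
theorem push_exec {R G : ℕ → ℕ} {Q κ i c : ℕ} {S : ℕ → List ℕ} (h4 : R 4 = Q) (hQ : 100 ≤ Q)
    (hi : i < κ) (hc : c < 2 ^ w) (hw : cellAddr Q κ i ((S i).length + 1) < 2 ^ w)
    (qs : List (List ℕ)) :
    Exec w O (block (pushOps κ i c)) ⟨merge R (dataMem G Q κ S), qs⟩
      ⟨merge (Function.update (Function.update R 5 (Q + i)) 6 (cellAddr Q κ i ((S i).length + 1)))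
        (dataMem G Q κ (Function.update S i (c :: S i))), qs⟩ 5 := by
  set p : ℕ := cellAddr Q κ i (S i).length with hp
  have hp1 : cellAddr Q κ i ((S i).length + 1) = p + κ := cellAddr_succ Q κ i _
  have hpQ : Q + κ ≤ p := le_cellAddr Q κ i _
  have hptr : dataMem G Q κ S (Q + i) = p := dataMem_ptr G Q S hi
  rw [hp1] at hw ⊢
  have key : ∀ Rf, execOps w (merge R (dataMem G Q κ S)) (pushOps κ i c) = Rf →
      Rf = merge (Function.update (Function.update R 5 (Q + i)) 6 (p + κ))
        (Function.update (Function.update (dataMem G Q κ S) (Q + i) (p + κ)) (p + κ) c) := by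
    intro Rf hR
    unfold pushOps at hR
    have htmp := execOps_cons_fwd hR; clear hR; obtain ⟨v1, hv1, hR⟩ := htmp
    simp -failIfUnchanged (disch := omega) only [Operand.write, Operand.read, merge_apply_of_lt,
      update_merge_of_lt,
      BinOp.eval_add_of_lt, h4]
      at hv1 hR
    have htmp := execOps_cons_fwd hR; clear hR; obtain ⟨v2, hv2, hR⟩ := htmp
    simp -failIfUnchanged (disch := omega) only [Operand.write, Operand.read, merge_apply_of_lt,
      merge_apply_of_le, Function.update_self, update_merge_of_lt,
      Nat.add_zero, BinOp.eval_add_of_lt, hptr,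
      ← hv1] at hv2 hR
    have htmp := execOps_cons_fwd hR; clear hR; obtain ⟨v3, hv3, hR⟩ := htmp
    simp -failIfUnchanged (disch := omega) only [Operand.write, Operand.read, merge_apply_of_lt,
      Function.update_self, update_merge_of_lt,
      BinOp.eval_add_of_lt,
      ← hv2] at hv3 hR
    have htmp := execOps_cons_fwd hR; clear hR; obtain ⟨v4, hv4, hR⟩ := htmp
    simp -failIfUnchanged (disch := omega) only [Operand.write, Operand.read, merge_apply_of_lt,
      Function.update_self, Function.update_of_ne,
      update_merge_of_le, Nat.add_zero, BinOp.eval_add_of_lt,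
      ← hv3] at hv4 hR
    have htmp := execOps_cons_fwd hR; clear hR; obtain ⟨v5, hv5, hR⟩ := htmp
    simp -failIfUnchanged (disch := omega) only [Operand.write, Operand.read, merge_apply_of_lt,
      Function.update_self,
      update_merge_of_le, Nat.add_zero, BinOp.eval_add_of_lt,
      ← hv4] at hv5 hR
    simp only [execOps_nil] at hR; subst hR
    subst hv1 hv2 hv3 hv4 hv5
    rw [Function.update_idem]
  have hfin := key _ rfl
  have hpush := dataMem_push G Q hi S c
  rw [hp1] at hpush
  rw [hpush] at hfin
  exact Exec.block' _ qs hfin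

/-- **Semantics of `popOps`** on a nonempty stack. [folklore] -/
theorem pop_exec {R G : ℕ → ℕ} {Q κ i : ℕ} {S : ℕ → List ℕ} (h4 : R 4 = Q) (hQ : 100 ≤ Q)
    (hi : i < κ) (hne : S i ≠ []) (hw : cellAddr Q κ i (S i).length < 2 ^ w)
    (qs : List (List ℕ)) :
    Exec w O (block (popOps κ i)) ⟨merge R (dataMem G Q κ S), qs⟩
      ⟨merge (Function.update (Function.update R 5 (Q + i)) 6 (cellAddr Q κ i ((S i).length - 1)))
        (dataMem G Q κ (Function.update S i (S i).tail)), qs⟩ 5 := by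
  have hlen : 0 < (S i).length := List.length_pos_of_ne_nil hne
  set p : ℕ := cellAddr Q κ i ((S i).length - 1) with hp
  have hp1 : cellAddr Q κ i (S i).length = p + κ := by
    rw [← cellAddr_succ, Nat.sub_add_cancel hlen]
  have hpQ : Q + κ ≤ p := le_cellAddr Q κ i _
  have hptr : dataMem G Q κ S (Q + i) = p + κ := by rw [dataMem_ptr G Q S hi, hp1]
  rw [hp1] at hw
  have key : ∀ Rf, execOps w (merge R (dataMem G Q κ S)) (popOps κ i) = Rf →
      Rf = merge (Function.update (Function.update R 5 (Q + i)) 6 p)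
        (Function.update (Function.update (dataMem G Q κ S) (p + κ) 0) (Q + i) p) := by
    intro Rf hR
    unfold popOps at hR
    have htmp := execOps_cons_fwd hR; clear hR; obtain ⟨v1, hv1, hR⟩ := htmp
    simp -failIfUnchanged (disch := omega) only [Operand.write, Operand.read, merge_apply_of_lt,
      update_merge_of_lt,
      BinOp.eval_add_of_lt, h4]
      at hv1 hR
    have htmp := execOps_cons_fwd hR; clear hR; obtain ⟨v2, hv2, hR⟩ := htmp
    simp -failIfUnchanged (disch := omega) only [Operand.write, Operand.read, merge_apply_of_lt,
      merge_apply_of_le, Function.update_self, update_merge_of_lt,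
      Nat.add_zero, BinOp.eval_add_of_lt, hptr,
      ← hv1]
      at hv2 hR
    have htmp := execOps_cons_fwd hR; clear hR; obtain ⟨v3, hv3, hR⟩ := htmp
    simp -failIfUnchanged (disch := omega) only [Operand.write, Operand.read, merge_apply_of_lt,
      Function.update_self,
      update_merge_of_le, Nat.add_zero, BinOp.eval_add_of_lt,
      ← hv2]
      at hv3 hR
    have htmp := execOps_cons_fwd hR; clear hR; obtain ⟨v4, hv4, hR⟩ := htmp
    simp -failIfUnchanged (disch := omega) only [Operand.write, Operand.read, merge_apply_of_lt,
      Function.update_self, update_merge_of_lt,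
      BinOp.eval_sub_of_le,
      ← hv3]
      at hv4 hR
    have htmp := execOps_cons_fwd hR; clear hR; obtain ⟨v5, hv5, hR⟩ := htmp
    simp -failIfUnchanged (disch := omega) only [Operand.write, Operand.read, merge_apply_of_lt,
      Function.update_self, Function.update_of_ne,
      update_merge_of_le, Nat.add_zero, BinOp.eval_add_of_lt,
      ← hv4]
      at hv5 hR
    simp only [execOps_nil] at hR; subst hR
    subst hv1 hv2 hv3 hv4 hv5
    rw [Function.update_idem, Nat.add_sub_cancel]
  have hfin := key _ rfl
  have hpop := dataMem_pop G Q hi S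
  rw [hp1] at hpop
  rw [hpop] at hfin
  exact Exec.block' _ qs hfin

/-- **Semantics of `topOps`**: register `7` receives the code of the top symbol of stack `i`
(`0` if the stack is empty). [folklore] -/
theorem top_exec {R G : ℕ → ℕ} {Q κ i : ℕ} {S : ℕ → List ℕ} (h4 : R 4 = Q) (hQ : 100 ≤ Q)
    (hi : i < κ) (hw : cellAddr Q κ i (S i).length < 2 ^ w) (htop : (S i).headD 0 < 2 ^ w)
    (qs : List (List ℕ)) :
    Exec w O (block (topOps i)) ⟨merge R (dataMem G Q κ S), qs⟩
      ⟨merge (Function.update (Function.update (Function.update R 5 (Q + i)) 6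
          (cellAddr Q κ i (S i).length)) 7 ((S i).headD 0)) (dataMem G Q κ S), qs⟩ 3 := by
  set p : ℕ := cellAddr Q κ i (S i).length with hp
  have hpQ : Q + κ ≤ p := le_cellAddr Q κ i _
  have hptr : dataMem G Q κ S (Q + i) = p := dataMem_ptr G Q S hi
  have hcell : dataMem G Q κ S p = (S i).headD 0 := by
    rw [hp, dataMem_cellAddr G Q S hi, stackCell_length]
  have key : ∀ Rf, execOps w (merge R (dataMem G Q κ S)) (topOps i) = Rf →
      Rf = merge (Function.update (Function.update (Function.update R 5 (Q + i)) 6 p) 7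
        ((S i).headD 0)) (dataMem G Q κ S) := by
    intro Rf hR
    unfold topOps at hR
    have htmp := execOps_cons_fwd hR; clear hR; obtain ⟨v1, hv1, hR⟩ := htmp
    simp -failIfUnchanged (disch := omega) only [Operand.write, Operand.read, merge_apply_of_lt,
      update_merge_of_lt,
      BinOp.eval_add_of_lt, h4]
      at hv1 hR
    have htmp := execOps_cons_fwd hR; clear hR; obtain ⟨v2, hv2, hR⟩ := htmp
    simp -failIfUnchanged (disch := omega) only [Operand.write, Operand.read, merge_apply_of_lt,
      merge_apply_of_le, Function.update_self, update_merge_of_lt,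
      Nat.add_zero, BinOp.eval_add_of_lt, hptr,
      ← hv1]
      at hv2 hR
    have htmp := execOps_cons_fwd hR; clear hR; obtain ⟨v3, hv3, hR⟩ := htmp
    simp -failIfUnchanged (disch := omega) only [Operand.write, Operand.read, merge_apply_of_lt,
      merge_apply_of_le, Function.update_self, update_merge_of_lt,
      Nat.add_zero, BinOp.eval_add_of_lt,
      ← hv2, hcell]
      at hv3 hR
    simp only [execOps_nil] at hR; subst hR
    subst hv1 hv2 hv3
    rfl
  exact Exec.block' _ qs (key _ rfl)

end blocks

/-! ## Dispatch by a chain of tests -/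

/-- `switchL cases`: compare register `7` with the keys of `cases` in turn (`r6 := (r7 = c)`)
and run the body of the first match; no match runs nothing. (The word RAM has no computed jump,
so a `case` statement is a chain of conditional jumps; its length is a constant of the simulated
machine.) [folklore] -/
def switchL : List (ℕ × SProg) → SProg
  | [] => skip
  | cb :: r => seq (op .eq (.dir 6) (.dir 7) (.imm cb.1)) (ifz (.dir 6) (switchL r) cb.2)

section switch

variable {w : ℕ} {O : List ℕ → List ℕ}

/-- **Semantics of `switchL`.** If register `7` holds a key `t` of `cases` (keys distinct) and the
body filed under `t` executes from the same store with register `6` set to `1`, then the switch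
executes to the same final store, in at most `2 |cases| + 1` more steps. [folklore] -/
theorem switchL_exec {cases : List (ℕ × SProg)} {t : ℕ} {b : SProg} (hmem : (t, b) ∈ cases)
    (hnd : (cases.map Prod.fst).Nodup) {R H : ℕ → ℕ} {qs : List (List ℕ)} (h7 : R 7 = t)
    {st' : Store} {tb : ℕ} (hb : Exec w O b ⟨merge (Function.update R 6 1) H, qs⟩ st' tb) :
    ∃ t', t' ≤ 2 * cases.length + 1 + tb ∧ Exec w O (switchL cases) ⟨merge R H, qs⟩ st' t' := by
  induction cases generalizing R with
  | nil => simp at hmem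
  | cons cb r ih =>
    obtain ⟨c, b'⟩ := cb
    simp only [List.map_cons, List.nodup_cons, List.mem_map] at hnd
    by_cases hc : c = t
    · subst hc
      have hb' : b' = b := by
        rcases List.mem_cons.1 hmem with h | h
        · exact (Prod.mk.inj h).2.symm
        · exact (hnd.1 ⟨(c, b), h, rfl⟩).elim
      subst hb'
      have hop : Exec w O (op .eq (.dir 6) (.dir 7) (.imm c)) ⟨merge R H, qs⟩
          ⟨merge (Function.update R 6 1) H, qs⟩ 1 :=
        Exec.op_dir' (by decide) (by simp [Operand.read_dir_merge (show 7 < 100 by decide), h7])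
      refine ⟨1 + (tb + 2), by simp; omega, Exec.seq hop (Exec.ifz_ne ?_ hb)⟩
      simp [Operand.read_dir_merge (show 6 < 100 by decide)]
    · have hop : Exec w O (op .eq (.dir 6) (.dir 7) (.imm c)) ⟨merge R H, qs⟩
          ⟨merge (Function.update R 6 0) H, qs⟩ 1 :=
        Exec.op_dir' (by decide) (by
          simp [Operand.read_dir_merge (show 7 < 100 by decide), h7, Ne.symm hc])
      have hmem' : (t, b) ∈ r := by
        rcases List.mem_cons.1 hmem with h | h
        · exact absurd (Prod.mk.inj h).1.symm hc
        · exact h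
      obtain ⟨t', ht', hex⟩ := ih hmem' hnd.2 (R := Function.update R 6 0)
        (by simp [h7]) (by rwa [Function.update_idem])
      refine ⟨1 + (t' + 1), by simp; omega, Exec.seq hop (Exec.ifz_zero ?_ hex)⟩
      simp [Operand.read_dir_merge (show 6 < 100 by decide)]

end switch

end SProg

/-! ## Numberings and the static-state compiler -/

/-- The numberings the compiler works with: stacks `ι : K → [0, κ)` (with inverse `ιinv`),
symbol codes `code k : Γ k → ℕ` (positive and `≤ γ` on the working alphabet, decoded by
`decode k`, code `0` meaning "empty stack"), label codes `lab : Λ → ℕ` (positive; `0` means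
halted) and state codes `st : σ → [0, sBase)`. [folklore] -/
structure Enc (K : Type) (Γ : K → Type) (Λ : Type) (σ : Type) where
  /-- The number of stacks. -/
  κ : ℕ
  /-- The index of a stack. -/
  ι : K → ℕ
  /-- The stack with a given index, if any. -/
  ιinv : ℕ → Option K
  /-- A bound on the symbol codes of the working alphabet. -/
  γ : ℕ
  /-- The code of a stack symbol. -/
  code : (k : K) → Γ k → ℕ
  /-- The symbol with a given code (`none` for `0` and for unused codes). -/
  decode : (k : K) → ℕ → Option (Γ k)
  /-- The code of a label. -/
  lab : Λ → ℕ
  /-- A bound on the state codes. -/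
  sBase : ℕ
  /-- The code of an internal state. -/
  st : σ → ℕ

namespace Enc

variable {K : Type} {Γ : K → Type} {Λ : Type} {σ : Type} (E : Enc K Γ Λ σ)

/-- The code of the current label, `0` for the halted machine. [folklore] -/
def labCode : Option Λ → ℕ
  | none => 0
  | some l => E.lab l

/-- The dispatch key of a (label, state) pair (used by the step loop of
`TM2ToWordRAMRun.lean`, which switches over all pairs). [folklore] -/
def key (l : Λ) (v : σ) : ℕ := E.lab l * E.sBase + E.st v

/-- The code lists (top first) of a stack configuration, indexed by stack number (empty at
numbers that are not the index of a stack). [folklore] -/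
def stk (S : ∀ k, List (Γ k)) : ℕ → List ℕ := fun i =>
  match E.ιinv i with
  | none => []
  | some k => (S k).map (E.code k)

/-- **The static-state compiler.** The word-RAM code of the statement `q` started in the
internal state `v`, which is a *compile-time constant*: a `push` pushes the literal code of
`f v`; a `load` continues compiling with the constant `f v`; a `branch` is resolved at compile
time; a `peek`/`pop` reads the top code into register `7`, dispatches on it (`switchL` over the
codes `0, …, γ`) and continues in branch `c` with the constant `f v (decode k c)` (popping first
if `c ≠ 0`, i.e. if the stack is nonempty); `goto`/`halt` write the codes of the final state and
of the next label (`0` = halted) into registers `3`, `2`. [folklore] -/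
def comp : TM2.Stmt Γ Λ σ → σ → SProg
  | .push k f q, v => .seq (.block (pushOps E.κ (E.ι k) (E.code k (f v)))) (comp q v)
  | .peek k f q, v => .seq (.block (topOps (E.ι k)))
      (SProg.switchL ((List.range (E.γ + 1)).map fun c => (c, comp q (f v (E.decode k c)))))
  | .pop k f q, v => .seq (.block (topOps (E.ι k)))
      (SProg.switchL ((List.range (E.γ + 1)).map fun c =>
        (c, .seq (if c = 0 then .skip else .block (popOps E.κ (E.ι k)))
          (comp q (f v (E.decode k c))))))
  | .load f q, v => comp q (f v)
  | .branch p q₁ q₂, v => bif p v then comp q₁ v else comp q₂ v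
  | .goto f, v => .block [(.add, .dir 3, .imm (E.st v), .imm 0), (.add, .dir 2, .imm (E.lab (f v)), .imm 0)]
  | .halt, v => .block [(.add, .dir 3, .imm (E.st v), .imm 0), (.add, .dir 2, .imm 0, .imm 0)]

/-- A bound on the running time of `comp E q v` (for every `v`). [folklore] -/
def cost : TM2.Stmt Γ Λ σ → ℕ
  | .push _ _ q => 5 + cost q
  | .peek _ _ q => 3 + (2 * (E.γ + 1) + 1) + cost q
  | .pop _ _ q => 3 + (2 * (E.γ + 1) + 1) + (5 + cost q)
  | .load _ q => cost q
  | .branch _ q₁ q₂ => max (cost q₁) (cost q₂)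
  | .goto _ => 2
  | .halt => 2

end Enc

/-! ## Correctness of the compiler -/

namespace Enc

variable {K : Type} {Γ : K → Type} {Λ : Type} {σ : Type} (E : Enc K Γ Λ σ)

/-- The requirements on the numberings, relative to a family `A` of working alphabets: stack
indices below `κ` with `ιinv` their inverse; symbol codes positive, at most `γ` and decoded
correctly on `A`, with `0` decoding to "empty"; label codes positive and injective; state codes
below `sBase` and injective. [folklore] -/
structure Good (A : ∀ k, Set (Γ k)) : Prop where
  /-- There is a stack (Mathlib's machines always have the input stack). -/
  κ_pos : 0 < E.κ
  /-- Stack indices are below `κ`. -/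
  ι_lt : ∀ k, E.ι k < E.κ
  /-- `ιinv` inverts `ι`. -/
  ιinv_iff : ∀ i k, E.ιinv i = some k ↔ E.ι k = i
  /-- Symbol codes are positive on the alphabet. -/
  code_pos : ∀ k a, a ∈ A k → 0 < E.code k a
  /-- Symbol codes are at most `γ` on the alphabet. -/
  code_le : ∀ k a, a ∈ A k → E.code k a ≤ E.γ
  /-- `decode` inverts `code` on the alphabet. -/
  decode_code : ∀ k a, a ∈ A k → E.decode k (E.code k a) = some a
  /-- Code `0` means "empty stack". -/
  decode_zero : ∀ k, E.decode k 0 = none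
  /-- Label codes are positive (`0` = halted). -/
  lab_pos : ∀ l, 0 < E.lab l
  /-- Label codes are injective. -/
  lab_inj : Function.Injective E.lab
  /-- `sBase` is positive (so that label codes are recovered from dispatch keys; implied by
  `st_lt` as soon as `σ` is inhabited, recorded for convenience). -/
  sBase_pos : 0 < E.sBase
  /-- State codes are below `sBase`. -/
  st_lt : ∀ v, E.st v < E.sBase
  /-- State codes are injective. -/
  st_inj : Function.Injective E.st

variable {E}

section stk

variable {A : ∀ k, Set (Γ k)} (hE : E.Good A)
include hE

/-- The code list filed under the index of stack `k` is that of stack `k`. [folklore] -/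
theorem stk_ι (S : ∀ k, List (Γ k)) (k : K) : E.stk S (E.ι k) = (S k).map (E.code k) := by
  have h : E.ιinv (E.ι k) = some k := (hE.ιinv_iff _ _).2 rfl
  simp only [stk, h]

/-- Updating stack `k` updates the code list at index `ι k`. [folklore] -/
theorem stk_update [DecidableEq K] (S : ∀ k, List (Γ k)) (k : K) (l : List (Γ k)) :
    E.stk (Function.update S k l) = Function.update (E.stk S) (E.ι k) (l.map (E.code k)) := by
  funext i
  by_cases hi : i = E.ι k
  · subst hi
    rw [Function.update_self, stk_ι hE, Function.update_self]
  · rw [Function.update_of_ne hi]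
    unfold stk
    cases h : E.ιinv i with
    | none => rfl
    | some k' =>
      have hk' : k' ≠ k := by
        rintro rfl
        exact hi ((hE.ιinv_iff _ _).1 h).symm
      simp only [Function.update_of_ne hk']

/-- The dispatch key of the top of a stack over the alphabet: at most `γ`. [folklore] -/
theorem headD_map_code_le {k : K} {l : List (Γ k)} (hl : ∀ a ∈ l, a ∈ A k) :
    (l.map (E.code k)).headD 0 ≤ E.γ := by
  cases l with
  | nil => simp
  | cons a l => simpa using hE.code_le k a (hl a (by simp))

/-- Decoding the top code gives the top symbol (`none` for the empty stack). [folklore] -/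
theorem decode_headD_map_code {k : K} {l : List (Γ k)} (hl : ∀ a ∈ l, a ∈ A k) :
    E.decode k ((l.map (E.code k)).headD 0) = l.head? := by
  cases l with
  | nil => simpa using hE.decode_zero k
  | cons a l => simpa using hE.decode_code k a (hl a (by simp))

/-- The top code is `0` exactly for the empty stack. [folklore] -/
theorem headD_map_code_eq_zero_iff {k : K} {l : List (Γ k)} (hl : ∀ a ∈ l, a ∈ A k) :
    (l.map (E.code k)).headD 0 = 0 ↔ l = [] := by
  cases l with
  | nil => simp
  | cons a l =>
    have := hE.code_pos k a (hl a (by simp))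
    simp only [List.map_cons, List.headD_cons, reduceCtorEq, iff_false]
    omega

end stk

section lemmas

variable [DecidableEq K] {A : ∀ k, Set (Γ k)}

/-- Pushing a symbol of the alphabet keeps all stacks inside the alphabet. [folklore] -/
theorem forall_mem_update_cons {S : ∀ k, List (Γ k)} (hS : ∀ k, ∀ a ∈ S k, a ∈ A k) {k : K}
    {b : Γ k} (hb : b ∈ A k) : ∀ k', ∀ a ∈ Function.update S k (b :: S k) k', a ∈ A k' := by
  intro k' a ha
  by_cases hk : k' = k
  · subst hk
    rw [Function.update_self, List.mem_cons] at ha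
    rcases ha with rfl | ha
    exacts [hb, hS _ a ha]
  · rw [Function.update_of_ne hk] at ha
    exact hS _ a ha

/-- Popping keeps all stacks inside the alphabet. [folklore] -/
theorem forall_mem_update_tail {S : ∀ k, List (Γ k)} (hS : ∀ k, ∀ a ∈ S k, a ∈ A k) (k : K) :
    ∀ k', ∀ a ∈ Function.update S k (S k).tail k', a ∈ A k' := by
  intro k' a ha
  by_cases hk : k' = k
  · subst hk
    rw [Function.update_self] at ha
    exact hS _ a (List.mem_of_mem_tail ha)
  · rw [Function.update_of_ne hk] at ha
    exact hS _ a ha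

end lemmas

/-- Cells of stacks of index `< κ` and height `≤ Hb` lie below `cellAddr Q κ κ Hb`. [folklore] -/
theorem cellAddr_lt_cellAddr {Q κ i j Hb : ℕ} (hi : i < κ) (hj : j ≤ Hb) :
    cellAddr Q κ i j < cellAddr Q κ κ Hb := by
  unfold cellAddr
  have := Nat.mul_le_mul_left κ hj
  omega

section setLV

variable {w : ℕ} {O : List ℕ → List ℕ}

/-- Writing the state code `a` and the label code `b` (the code of `goto`/`halt`). [folklore] -/
theorem setLV_exec {R H : ℕ → ℕ} {a b : ℕ} (ha : a < 2 ^ w) (hb : b < 2 ^ w)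
    (qs : List (List ℕ)) :
    SProg.Exec w O (.block [(.add, .dir 3, .imm a, .imm 0), (.add, .dir 2, .imm b, .imm 0)])
      ⟨merge R H, qs⟩ ⟨merge (Function.update (Function.update R 3 a) 2 b) H, qs⟩ 2 := by
  have key : ∀ Rf, execOps w (merge R H)
      [(.add, .dir 3, .imm a, .imm 0), (.add, .dir 2, .imm b, .imm 0)] = Rf →
      Rf = merge (Function.update (Function.update R 3 a) 2 b) H := by
    intro Rf hR
    have htmp := execOps_cons_fwd hR; clear hR; obtain ⟨v1, hv1, hR⟩ := htmp
    simp -failIfUnchanged (disch := omega) only [Operand.write, Operand.read,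
      update_merge_of_lt,
      Nat.add_zero, BinOp.eval_add_of_lt] at hv1 hR
    have htmp := execOps_cons_fwd hR; clear hR; obtain ⟨v2, hv2, hR⟩ := htmp
    simp -failIfUnchanged (disch := omega) only [Operand.write, Operand.read,
      update_merge_of_lt,
      Nat.add_zero, BinOp.eval_add_of_lt, ← hv1] at hv2 hR
    simp only [execOps_nil] at hR; subst hR
    subst hv1 hv2
    rfl
  exact SProg.Exec.block' _ qs (key _ rfl)

end setLV

section comp

variable (E) [DecidableEq K] {A : ∀ k, Set (Γ k)} (hE : E.Good A) {w : ℕ} {O : List ℕ → List ℕ}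
  {Q : ℕ} (hQ : 100 ≤ Q) (G : ℕ → ℕ) (qs : List (List ℕ)) {Hb : ℕ}
  (hw : cellAddr Q E.κ E.κ Hb < 2 ^ w) (hγ : E.γ < 2 ^ w) (hst : ∀ v, E.st v < 2 ^ w)
  (hlab : ∀ l, E.lab l < 2 ^ w)
include hE hQ hw hγ hst hlab

/-- **Correctness of the static-state compiler.** From a store whose data part is the memory of
the stacks `S` (over an alphabet family `A` containing every symbol pushable by `q` —
`TM2Sim.PushesSym` of `TM2Window.lean` — of heights leaving room for the `TM2Comp.pushBound q`
pushes of `q` below the bound `Hb` that fits in a word) and whose register `4` holds the base `Q`,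
the code `comp E q v`
executes within `cost E q` steps to a store whose data part is the memory of the stacks of
`TM2.stepAux q v S`, with the codes of its label and internal state in registers `2` and `3`
(and `Q` still in register `4`). [folklore] -/
theorem comp_exec :
    ∀ (q : TM2.Stmt Γ Λ σ) (v : σ) (S : ∀ k, List (Γ k)),
      (∀ k γ, Complexity.TM2Sim.PushesSym q k γ → γ ∈ A k) →
      (∀ k, ∀ a ∈ S k, a ∈ A k) → (∀ k, (S k).length + Complexity.TM2Comp.pushBound q ≤ Hb) →
      ∀ R : ℕ → ℕ, R 4 = Q →
      ∃ (R' : ℕ → ℕ) (t : ℕ),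
        SProg.Exec w O (E.comp q v) ⟨merge R (dataMem G Q E.κ (E.stk S)), qs⟩
          ⟨merge R' (dataMem G Q E.κ (E.stk (TM2.stepAux q v S).stk)), qs⟩ t ∧
        t ≤ E.cost q ∧ R' 4 = Q ∧ R' 2 = E.labCode (TM2.stepAux q v S).l ∧
        R' 3 = E.st (TM2.stepAux q v S).var
  | .push k f q, v, S, hq, hS, hlen, R, h4 => by
    have hi := hE.ι_lt k
    have hfv : f v ∈ A k := hq k (f v) (Complexity.TM2Sim.PushesSym.push_here f q v)
    have hq' : ∀ k' γ, Complexity.TM2Sim.PushesSym q k' γ → γ ∈ A k' := fun k' γ h =>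
      hq k' γ (Complexity.TM2Sim.PushesSym.push_below f q h)
    have hlenk : (E.stk S (E.ι k)).length = (S k).length := by rw [stk_ι hE, List.length_map]
    have hHb : (S k).length + 1 ≤ Hb := by
      have := hlen k; simp only [Complexity.TM2Comp.pushBound] at this; omega
    have hc : E.code k (f v) < 2 ^ w := lt_of_le_of_lt (hE.code_le k _ hfv) hγ
    have hw' : cellAddr Q E.κ (E.ι k) ((E.stk S (E.ι k)).length + 1) < 2 ^ w := by
      rw [hlenk]; exact (cellAddr_lt_cellAddr hi hHb).trans hw
    have h1 := SProg.push_exec (O := O) (G := G) (S := E.stk S) h4 hQ hi hc hw' qs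
    have hstk : Function.update (E.stk S) (E.ι k) (E.code k (f v) :: E.stk S (E.ι k)) =
        E.stk (Function.update S k (f v :: S k)) := by
      rw [stk_update hE, List.map_cons, stk_ι hE]
    rw [hstk] at h1
    have h4₁ : (Function.update (Function.update R 5 (Q + E.ι k)) 6
        (cellAddr Q E.κ (E.ι k) ((E.stk S (E.ι k)).length + 1))) 4 = Q := by simp [h4]
    obtain ⟨R', t, h2, ht, h4', h2', h3'⟩ := comp_exec q v (Function.update S k (f v :: S k)) hq'
      (forall_mem_update_cons hS hfv)
      (fun k' => by
        have := hlen k'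
        simp only [Complexity.TM2Comp.pushBound] at this
        by_cases hk : k' = k
        · subst hk; rw [Function.update_self, List.length_cons]; omega
        · rw [Function.update_of_ne hk]; omega)
      _ h4₁
    exact ⟨R', 5 + t, SProg.Exec.seq h1 h2, by simp only [cost]; omega, h4', h2', h3'⟩
  | .peek k f q, v, S, hq, hS, hlen, R, h4 => by
    have hi := hE.ι_lt k
    have hq' : ∀ k' γ, Complexity.TM2Sim.PushesSym q k' γ → γ ∈ A k' := fun k' γ h =>
      hq k' γ (Complexity.TM2Sim.PushesSym.peek f q h)
    have hSk : ∀ a ∈ S k, a ∈ A k := hS k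
    have hlenk : (E.stk S (E.ι k)).length = (S k).length := by rw [stk_ι hE, List.length_map]
    have hHb : (S k).length ≤ Hb := by
      have := hlen k; simp only [Complexity.TM2Comp.pushBound] at this; omega
    have hw' : cellAddr Q E.κ (E.ι k) (E.stk S (E.ι k)).length < 2 ^ w := by
      rw [hlenk]; exact (cellAddr_lt_cellAddr hi hHb).trans hw
    set t : ℕ := ((S k).map (E.code k)).headD 0 with ht
    have htγ : t ≤ E.γ := headD_map_code_le hE hSk
    have htop : (E.stk S (E.ι k)).headD 0 = t := by rw [stk_ι hE]
    have h1 := SProg.top_exec (O := O) (G := G) (S := E.stk S) h4 hQ hi hw' (by rw [htop]; omega) qs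
    rw [htop] at h1
    set R₁ : ℕ → ℕ := Function.update (Function.update (Function.update R 5 (Q + E.ι k)) 6
      (cellAddr Q E.κ (E.ι k) (E.stk S (E.ι k)).length)) 7 t with hR₁
    have hdec : f v (E.decode k t) = f v (S k).head? := by rw [ht, decode_headD_map_code hE hSk]
    obtain ⟨R', tb, h2, htb, h4', h2', h3'⟩ := comp_exec q (f v (E.decode k t)) S hq' hS
      (fun k' => by have := hlen k'; simp only [Complexity.TM2Comp.pushBound] at this; omega)
      (Function.update R₁ 6 1) (by simp [hR₁, h4])
    have hmem : (t, E.comp q (f v (E.decode k t))) ∈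
        (List.range (E.γ + 1)).map fun c => (c, E.comp q (f v (E.decode k c))) :=
      List.mem_map.2 ⟨t, List.mem_range.2 (by omega), rfl⟩
    have hnd : (((List.range (E.γ + 1)).map fun c =>
        (c, E.comp q (f v (E.decode k c)))).map Prod.fst).Nodup := by
      have : (((List.range (E.γ + 1)).map fun c =>
          (c, E.comp q (f v (E.decode k c)))).map Prod.fst) = List.range (E.γ + 1) := by
        simp [List.map_map, Function.comp_def]
      rw [this]; exact List.nodup_range
    obtain ⟨t', ht', h3⟩ := SProg.switchL_exec hmem hnd (by simp [hR₁]) h2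
    rw [hdec] at h3 h2' h3'
    refine ⟨R', 3 + t', SProg.Exec.seq h1 h3, ?_, h4', h2', h3'⟩
    simp only [cost, List.length_map, List.length_range] at ht' ⊢
    omega
  | .pop k f q, v, S, hq, hS, hlen, R, h4 => by
    have hi := hE.ι_lt k
    have hq' : ∀ k' γ, Complexity.TM2Sim.PushesSym q k' γ → γ ∈ A k' := fun k' γ h =>
      hq k' γ (Complexity.TM2Sim.PushesSym.pop f q h)
    have hSk : ∀ a ∈ S k, a ∈ A k := hS k
    have hlenk : (E.stk S (E.ι k)).length = (S k).length := by rw [stk_ι hE, List.length_map]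
    have hHb : (S k).length ≤ Hb := by
      have := hlen k; simp only [Complexity.TM2Comp.pushBound] at this; omega
    have hw' : cellAddr Q E.κ (E.ι k) (E.stk S (E.ι k)).length < 2 ^ w := by
      rw [hlenk]; exact (cellAddr_lt_cellAddr hi hHb).trans hw
    set t : ℕ := ((S k).map (E.code k)).headD 0 with ht
    have htγ : t ≤ E.γ := headD_map_code_le hE hSk
    have htop : (E.stk S (E.ι k)).headD 0 = t := by rw [stk_ι hE]
    have h1 := SProg.top_exec (O := O) (G := G) (S := E.stk S) h4 hQ hi hw' (by rw [htop]; omega) qs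
    rw [htop] at h1
    set R₁ : ℕ → ℕ := Function.update (Function.update (Function.update R 5 (Q + E.ι k)) 6
      (cellAddr Q E.κ (E.ι k) (E.stk S (E.ι k)).length)) 7 t with hR₁
    have hdec : f v (E.decode k t) = f v (S k).head? := by rw [ht, decode_headD_map_code hE hSk]
    -- the body: pop (if nonempty), then the continuation
    have hbody : ∃ (R' : ℕ → ℕ) (tb : ℕ),
        SProg.Exec w O (.seq (if t = 0 then .skip else .block (popOps E.κ (E.ι k)))
            (E.comp q (f v (E.decode k t))))
          ⟨merge (Function.update R₁ 6 1) (dataMem G Q E.κ (E.stk S)), qs⟩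
          ⟨merge R' (dataMem G Q E.κ (E.stk
            (TM2.stepAux q (f v (E.decode k t)) (Function.update S k (S k).tail)).stk)), qs⟩ tb ∧
        tb ≤ 5 + E.cost q ∧ R' 4 = Q ∧
        R' 2 = E.labCode (TM2.stepAux q (f v (E.decode k t)) (Function.update S k (S k).tail)).l ∧
        R' 3 = E.st (TM2.stepAux q (f v (E.decode k t)) (Function.update S k (S k).tail)).var := by
      have hlen' : ∀ k', (Function.update S k (S k).tail k').length +
          Complexity.TM2Comp.pushBound q ≤ Hb := by
        intro k'
        have := hlen k'
        simp only [Complexity.TM2Comp.pushBound] at this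
        by_cases hk : k' = k
        · subst hk; rw [Function.update_self, List.length_tail]; omega
        · rw [Function.update_of_ne hk]; omega
      by_cases ht0 : t = 0
      · have hnil : S k = [] := (headD_map_code_eq_zero_iff hE hSk).1 ht0
        have hS' : Function.update S k (S k).tail = S := by
          rw [hnil, List.tail_nil, ← hnil, Function.update_eq_self]
        obtain ⟨R', tb, h2, htb, h4', h2', h3'⟩ := comp_exec q (f v (E.decode k t))
          (Function.update S k (S k).tail) hq' (forall_mem_update_tail hS k) hlen'
          (Function.update R₁ 6 1) (by simp [hR₁, h4])
        refine ⟨R', 0 + tb, ?_, by omega, h4', h2', h3'⟩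
        rw [if_pos ht0]
        rw [hS'] at h2 ⊢
        exact SProg.Exec.seq (SProg.Exec.skip _) h2
      · have hne : S k ≠ [] := fun h => ht0 ((headD_map_code_eq_zero_iff hE hSk).2 h)
        have hne' : E.stk S (E.ι k) ≠ [] := by rw [stk_ι hE]; simpa using hne
        have hp := SProg.pop_exec (O := O) (G := G) (R := Function.update R₁ 6 1) (S := E.stk S)
          (by simp [hR₁, h4]) hQ hi hne' hw' qs
        have hstk : Function.update (E.stk S) (E.ι k) (E.stk S (E.ι k)).tail =
            E.stk (Function.update S k (S k).tail) := by
          rw [stk_update hE, stk_ι hE, List.map_tail]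
        rw [hstk] at hp
        have h4₂ : (Function.update (Function.update (Function.update R₁ 6 1) 5 (Q + E.ι k)) 6
            (cellAddr Q E.κ (E.ι k) ((E.stk S (E.ι k)).length - 1))) 4 = Q := by simp [hR₁, h4]
        obtain ⟨R', tb, h2, htb, h4', h2', h3'⟩ := comp_exec q (f v (E.decode k t))
          (Function.update S k (S k).tail) hq' (forall_mem_update_tail hS k) hlen' _ h4₂
        refine ⟨R', 5 + tb, ?_, by omega, h4', h2', h3'⟩
        rw [if_neg ht0]
        exact SProg.Exec.seq hp h2
    obtain ⟨R', tb, h2, htb, h4', h2', h3'⟩ := hbody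
    have hmem : (t, SProg.seq (if t = 0 then .skip else .block (popOps E.κ (E.ι k)))
          (E.comp q (f v (E.decode k t)))) ∈
        (List.range (E.γ + 1)).map fun c => (c, SProg.seq
          (if c = 0 then .skip else .block (popOps E.κ (E.ι k))) (E.comp q (f v (E.decode k c)))) :=
      List.mem_map.2 ⟨t, List.mem_range.2 (by omega), rfl⟩
    have hnd : (((List.range (E.γ + 1)).map fun c => (c, SProg.seq
        (if c = 0 then .skip else .block (popOps E.κ (E.ι k)))
          (E.comp q (f v (E.decode k c))))).map Prod.fst).Nodup := by
      have : (((List.range (E.γ + 1)).map fun c => (c, SProg.seq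
          (if c = 0 then .skip else .block (popOps E.κ (E.ι k)))
            (E.comp q (f v (E.decode k c))))).map Prod.fst) = List.range (E.γ + 1) := by
        simp [List.map_map, Function.comp_def]
      rw [this]; exact List.nodup_range
    obtain ⟨t', ht', h3⟩ := SProg.switchL_exec hmem hnd (by simp [hR₁]) h2
    rw [hdec] at h3 h2' h3'
    refine ⟨R', 3 + t', SProg.Exec.seq h1 h3, ?_, h4', h2', h3'⟩
    simp only [cost, List.length_map, List.length_range] at ht' ⊢
    omega
  | .load f q, v, S, hq, hS, hlen, R, h4 =>
    comp_exec q (f v) S (fun k' γ h => hq k' γ (Complexity.TM2Sim.PushesSym.load f q h)) hS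
      (fun k => by simpa [Complexity.TM2Comp.pushBound] using hlen k) R h4
  | .branch p q₁ q₂, v, S, hq, hS, hlen, R, h4 => by
    simp only [comp, TM2.stepAux, cost]
    cases p v
    · obtain ⟨R', t, h, ht, hr⟩ := comp_exec q₂ v S
        (fun k' γ h => hq k' γ (Complexity.TM2Sim.PushesSym.branch_right p q₁ q₂ h)) hS
        (fun k => by have := hlen k; simp only [Complexity.TM2Comp.pushBound] at this; omega) R h4
      exact ⟨R', t, h, ht.trans (le_max_right _ _), hr⟩
    · obtain ⟨R', t, h, ht, hr⟩ := comp_exec q₁ v S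
        (fun k' γ h => hq k' γ (Complexity.TM2Sim.PushesSym.branch_left p q₁ q₂ h)) hS
        (fun k => by have := hlen k; simp only [Complexity.TM2Comp.pushBound] at this; omega) R h4
      exact ⟨R', t, h, ht.trans (le_max_left _ _), hr⟩
  | .goto f, v, S, _, _, _, R, h4 =>
    ⟨_, 2, setLV_exec (hst v) (hlab (f v)) qs, by simp [cost], by simp [h4], by simp [labCode],
      by simp⟩
  | .halt, v, S, _, _, _, R, h4 =>
    ⟨_, 2, setLV_exec (hst v) (by omega) qs, by simp [cost], by simp [h4], by simp [labCode], by simp⟩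

end comp

end Enc

end Literature.Computability.Cryptography.WordRAM
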